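import Summits.PneNP.PneNP.Theorems.CliqueExtLowerBound.Negative.LargeCliquesTwoSat
import Literature.Computability.Complexity.ExtMonotoneCircuits

/-!
# `CliqueExtLowerBound` (stmt-PneNP-10682) — negative-side lemmas: very large cliques II (the cut programme as a circuit)

Continuation of `LargeCliquesTwoSat.lean` (see its docblock for the story). This file: §3 bounded
reachability as an iterated finite-set operator (`reachSet`, stabilisation after `card` rounds,
`mem_reachSet_card_iff`); §4 the cut programme as a straight-line program over any basis containing the
unbounded fan-in `∧`, `∨` gates (`GoodBasis`; the extended monotone basis `extGate s`, `s ≥ 1`, qualifies —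
every `∧ₙ`, `∨ₙ` is a CONV gate of width one): `cktSize_cutTest` (one colouring, `cutCircuitSize m = O(m⁴)`
gates, semantics `iterate_roundF_initF`), `cktSize_family` (OR over a family of colourings).
Refuter seat cdisprove-stmt-PneNP-10682-g2, 2026-08-16.
-/

namespace Summit.PneNP.PneNP.Theorems.CliqueExtLowerBound.Negative

open Literature.Computability.Complexity Literature.Computability.Complexity.CliqueLPGate Finset

/-! ### 3. Bounded reachability as an iterated finite-set operator (semantics of the cut programme) -/

section Reach

variable {L : Type*} [DecidableEq L] (succ : L → Finset L)

/-- One more step at the end: `T ∪ succ(T)`. [folklore] -/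
def nextSet (T : Finset L) : Finset L := T ∪ T.biUnion succ

/-- `T ⊆ nextSet T`. [folklore] -/
theorem subset_nextSet (T : Finset L) : T ⊆ nextSet succ T := Finset.subset_union_left

/-- `nextSet` is monotone. [folklore] -/
theorem nextSet_mono {T T' : Finset L} (h : T ⊆ T') : nextSet succ T ⊆ nextSet succ T' :=
  Finset.union_subset_union h (Finset.biUnion_subset_biUnion_of_subset_left _ h)

/-- Vertices reachable from `a` in at most `n` steps. [folklore] -/
def reachSet (a : L) (n : ℕ) : Finset L := (nextSet succ)^[n] {a}

/-- Round zero. [folklore] -/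
@[simp] theorem reachSet_zero (a : L) : reachSet succ a 0 = {a} := rfl

/-- Round `n + 1`. [folklore] -/
theorem reachSet_succ (a : L) (n : ℕ) : reachSet succ a (n + 1) = nextSet succ (reachSet succ a n) := by
  rw [reachSet, Function.iterate_succ_apply']; rfl

/-- The source is always reached. [folklore] -/
theorem mem_reachSet_self (a : L) (n : ℕ) : a ∈ reachSet succ a n := by
  induction n with
  | zero => simp
  | succ n ih => rw [reachSet_succ]; exact subset_nextSet succ _ ih

/-- Rounds only add vertices. [folklore] -/
theorem reachSet_mono (a : L) {n n' : ℕ} (h : n ≤ n') : reachSet succ a n ⊆ reachSet succ a n' := by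
  induction h with
  | refl => exact le_rfl
  | step _ ih => exact ih.trans (by rw [reachSet_succ]; exact subset_nextSet succ _)

/-- Once a round adds nothing, no later round does. [folklore] -/
theorem reachSet_stable (a : L) {j : ℕ} (hj : reachSet succ a (j + 1) = reachSet succ a j) :
    ∀ n, j ≤ n → reachSet succ a n = reachSet succ a j := by
  intro n hn
  induction n with
  | zero => simp at hn; subst hn; rfl
  | succ n ih =>
    rcases Nat.eq_or_lt_of_le hn with h | h
    · rw [h]
    · rw [reachSet_succ, ih (by omega), ← reachSet_succ, hj]

/-- Growth: before stabilisation every round adds a vertex. [folklore] -/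
theorem card_reachSet_or_stable (a : L) (n : ℕ) :
    n + 1 ≤ (reachSet succ a n).card ∨ ∃ j < n, reachSet succ a (j + 1) = reachSet succ a j := by
  induction n with
  | zero => left; simp
  | succ n ih =>
    rcases ih with h | ⟨j, hj, hst⟩
    · by_cases hst : reachSet succ a (n + 1) = reachSet succ a n
      · exact Or.inr ⟨n, Nat.lt_succ_self n, hst⟩
      · left
        have hss : reachSet succ a n ⊂ reachSet succ a (n + 1) :=
          Finset.ssubset_iff_subset_ne.2 ⟨reachSet_mono succ a (Nat.le_succ n), fun h' => hst h'.symm⟩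
        have := Finset.card_lt_card hss
        omega
    · exact Or.inr ⟨j, by omega, hst⟩

/-- After `card L` rounds the reachable set is closed under `succ`. [folklore] -/
theorem reachSet_card_closed [Fintype L] (a : L) {b c : L} (hb : b ∈ reachSet succ a (Fintype.card L))
    (hc : c ∈ succ b) : c ∈ reachSet succ a (Fintype.card L) := by
  -- stabilisation happens at some `j < card L`
  obtain ⟨j, hj, hst⟩ : ∃ j < Fintype.card L, reachSet succ a (j + 1) = reachSet succ a j := by
    rcases card_reachSet_or_stable succ a (Fintype.card L) with h | h
    · have := Finset.card_le_univ (reachSet succ a (Fintype.card L))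
      omega
    · exact h
  have hN : reachSet succ a (Fintype.card L) = reachSet succ a j := reachSet_stable succ a hst _ hj.le
  have hN1 : reachSet succ a (Fintype.card L + 1) = reachSet succ a j :=
    reachSet_stable succ a hst _ (by omega)
  rw [hN, ← hN1, reachSet_succ, nextSet]
  exact Finset.mem_union_right _ (Finset.mem_biUnion.2 ⟨b, hb, hc⟩)

/-- **Semantics**: after `card L` rounds, `reachSet` is exactly reflexive-transitive reachability along
`c ∈ succ b`. [folklore] -/
theorem mem_reachSet_card_iff [Fintype L] (a b : L) :
    b ∈ reachSet succ a (Fintype.card L) ↔ Relation.ReflTransGen (fun b c => c ∈ succ b) a b := by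
  constructor
  · -- every element of `reachSet a n` is reachable
    suffices h : ∀ n, ∀ b ∈ reachSet succ a n, Relation.ReflTransGen (fun b c => c ∈ succ b) a b from
      h _ b
    intro n
    induction n with
    | zero => intro b hb; simp at hb; subst hb; exact Relation.ReflTransGen.refl
    | succ n ih =>
      intro b hb
      rw [reachSet_succ, nextSet, Finset.mem_union, Finset.mem_biUnion] at hb
      rcases hb with hb | ⟨c, hc, hcb⟩
      · exact ih b hb
      · exact (ih c hc).tail hcb
  · intro h
    induction h with
    | refl => exact mem_reachSet_self succ a _
    | tail _ hbc ih => exact reachSet_card_closed succ a ih hbc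

end Reach


/-! ### 4. The cut programme as a circuit over the extended monotone basis -/

section CutCircuit

variable {m k : ℕ}

/-- Literals `p_u` (`(u, true)`) and `¬p_u` (`(u, false)`). [folklore] -/
abbrev Lt (m : ℕ) : Type := Fin m × Bool

/-- Edge variables of `K_m`. [folklore] -/
abbrev Ed (m : ℕ) : Type := (⊤ : SimpleGraph (Fin m)).edgeSet

/-- "Arc `a → b` present at input `x`", as a Boolean. [folklore] -/
def arcB (h : Fin m → Fin k) (x : Ed m → Bool) (a b : Lt m) : Bool :=
  (a.2 && !b.2 && decide (a.1 ≠ b.1) && decide (h a.1 = h b.1)) ||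
  (!a.2 && b.2 && (if hne : a.1 ≠ b.1 then !(x (edgeOf hne)) else false))

/-- `arcB` decides `Arc`. [folklore] -/
theorem arcB_eq_true_iff (h : Fin m → Fin k) (x : Ed m → Bool) (a b : Lt m) :
    arcB h x a b = true ↔ Arc h x a b := by
  rcases a with ⟨u, bu⟩; rcases b with ⟨v, bv⟩
  by_cases hne : u ≠ v
  · cases bu <;> cases bv <;> simp [arcB, Arc, hne]
  · push Not at hne
    subst hne
    cases bu <;> cases bv <;> simp [arcB, Arc]

/-- Out-neighbours at input `x`. [folklore] -/
def succB (h : Fin m → Fin k) (x : Ed m → Bool) (a : Lt m) : Finset (Lt m) :=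
  Finset.univ.filter fun b => arcB h x a b = true

/-- `Cut` is non-membership in the reachable set after `card` rounds. [folklore] -/
theorem cut_iff_not_mem_reachSet (h : Fin m → Fin k) (x : Ed m → Bool) (a b : Lt m) :
    Cut h x a b ↔ b ∉ reachSet (succB h x) a (Fintype.card (Lt m)) := by
  rw [Cut, mem_reachSet_card_iff]
  have : (fun b c : Lt m => c ∈ succB h x b) = Arc h x := by
    funext b c
    rw [succB, Finset.mem_filter, arcB_eq_true_iff]
    simp
  rw [this]

/-- "No arc `c → b`" as a Boolean function of the input. [folklore] -/
def noArcB (h : Fin m → Fin k) (c b : Lt m) : (Ed m → Bool) → Bool := fun x => !(arcB h x c b)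

/-- Trichotomy: `noArcB` is constantly `true`, constantly `false`, or a variable. [folklore] -/
theorem noArcB_cases (h : Fin m → Fin k) (c b : Lt m) :
    noArcB h c b = (fun _ => true) ∨ noArcB h c b = (fun _ => false) ∨ ∃ e : Ed m, noArcB h c b = fun x => x e := by
  rcases c with ⟨u, bu⟩; rcases b with ⟨v, bv⟩
  by_cases hne : u ≠ v
  · cases bu <;> cases bv
    · left; funext x; simp [noArcB, arcB]
    · right; right; exact ⟨edgeOf hne, funext fun x => by simp [noArcB, arcB, dif_pos hne]⟩
    · by_cases hh : h u = h v
      · right; left; funext x; simp [noArcB, arcB, hne, hh]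
      · left; funext x; simp [noArcB, arcB, hh]
    · left; funext x; simp [noArcB, arcB]
  · left; funext x
    push Not at hne; subst hne
    cases bu <;> cases bv <;> simp [noArcB, arcB]

/-- Basis requirements on `B`: unbounded fan-in `∧ₙ`, `∨ₙ` for every `n` (fan-in 0 = the constants,
fan-in 2 = `∧₂`, `∨₂`). [folklore] -/
structure GoodBasis (B : Set GateFn) : Prop where
  and_mem : ∀ n, GateFn.and n ∈ B
  or_mem : ∀ n, GateFn.or n ∈ B

variable {B : Set GateFn}

/-- The extended monotone basis `B_s`, `s ≥ 1`, is a good basis (threshold gates are CONV gates of width one). [folklore] -/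
theorem GoodBasis.extGate {s : ℕ} (hs : 1 ≤ s) : GoodBasis (extGate s) :=
  ⟨fun n => ExtMonotoneGate.and n hs, fun n => ExtMonotoneGate.or n hs⟩

section Generic

variable {ι : Type*} (hB : GoodBasis B)
include hB

/-- Constants cost one gate (`∧₀ = ⊤`, `∨₀ = ⊥`). [folklore] -/
theorem cktSize_constB (b : Bool) : CktSize B (fun (_ : ι → Bool) (_ : Unit) => b) 1 := by
  cases b
  · exact (CktSize.gate (B := B) (GateFn.or 0) (hB.or_mem 0) Fin.elim0).congr fun x u => by
      simp [GateFn.or]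
  · exact (CktSize.gate (B := B) (GateFn.and 0) (hB.and_mem 0) Fin.elim0).congr fun x u => by
      simp [GateFn.and]

/-- The unbounded fan-in AND of all coordinates costs one gate. [folklore] -/
theorem cktSize_andAll [Fintype ι] : CktSize B (fun (y : ι → Bool) (_ : Unit) => decide (∀ i, y i = true)) 1 := by
  classical
  let e := Fintype.equivFin ι
  exact (CktSize.gate (B := B) (GateFn.and (Fintype.card ι)) (hB.and_mem _) (fun a => e.symm a)).congr
    fun y u => by
      simp only [GateFn.and]
      apply Bool.decide_congr
      exact ⟨fun h i => by simpa using h (e i), fun h a => h _⟩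

/-- The unbounded fan-in OR of all coordinates costs one gate. [folklore] -/
theorem cktSize_orAll [Fintype ι] : CktSize B (fun (y : ι → Bool) (_ : Unit) => decide (∃ i, y i = true)) 1 := by
  classical
  let e := Fintype.equivFin ι
  exact (CktSize.gate (B := B) (GateFn.or (Fintype.card ι)) (hB.or_mem _) (fun a => e.symm a)).congr
    fun y u => by
      simp only [GateFn.or]
      apply Bool.decide_congr
      exact ⟨fun ⟨a, ha⟩ => ⟨_, ha⟩, fun ⟨i, hi⟩ => ⟨e i, by simpa using hi⟩⟩

/-- `y i ∨ y j` costs one gate. [folklore] -/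
theorem cktSize_or2 (i j : ι) : CktSize B (fun (y : ι → Bool) (_ : Unit) => (y i || y j)) 1 :=
  (CktSize.gate (B := B) (GateFn.or 2) (hB.or_mem 2) ![i, j]).congr fun y u => by
    simp only [GateFn.or, Fin.exists_fin_two, Matrix.cons_val_zero, Matrix.cons_val_one]
    cases hi : y i <;> cases hj : y j <;> simp

end Generic

variable (h : Fin m → Fin k) (hB : GoodBasis B)

/-- State of the programme: a copy of the input and the current non-reachability table. [folklore] -/
abbrev St (m : ℕ) : Type := Ed m ⊕ (Lt m × Lt m)

/-- One round: `C'(a,b) = C(a,b) ∧ ⋀_c (C(a,c) ∨ noArc(c,b))`, input copied. [folklore] -/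
def roundF (y : St m → Bool) : St m → Bool :=
  Sum.elim (fun e => y (Sum.inl e)) fun ab =>
    (y (Sum.inr ab) && decide (∀ c : Lt m, (y (Sum.inr (ab.1, c)) || noArcB h c ab.2 (fun e => y (Sum.inl e))) = true))

/-- Initial state: input and `C₀(a,b) = [b ≠ a]`. [folklore] -/
def initF (x : Ed m → Bool) : St m → Bool :=
  Sum.elim x fun ab => decide (ab.2 ≠ ab.1)

include hB

/-- One term `C(a,c) ∨ noArc(c,b)` costs at most one gate. [folklore] -/
theorem cktSize_term (a b c : Lt m) :
    CktSize B (fun (y : St m → Bool) (_ : Unit) =>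
      (y (Sum.inr (a, c)) || noArcB h c b (fun e => y (Sum.inl e)))) 1 := by
  rcases noArcB_cases h c b with hc | hc | ⟨e, hc⟩
  · exact (cktSize_constB hB true).congr fun y u => by simp [hc]
  · exact ((CktSize.proj B fun _ : Unit => (Sum.inr (a, c) : St m)).of_le (Nat.zero_le 1)).congr
      fun y u => by simp [hc]
  · exact (cktSize_or2 hB (Sum.inr (a, c)) (Sum.inl e)).congr fun y u => by simp [hc]

/-- One output of a round costs at most `card + 2` gates. [folklore] -/
theorem cktSize_roundEntry (ab : Lt m × Lt m) :
    CktSize B (fun (y : St m → Bool) (_ : Unit) => roundF h y (Sum.inr ab))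
      (Fintype.card (Option (Lt m)) * 1 + 1) := by
  classical
  -- the vector (C(a,b), terms_c)
  have hvec : CktSize B (fun (y : St m → Bool) (o : Option (Lt m)) => o.elim (y (Sum.inr ab))
      fun c => (y (Sum.inr (ab.1, c)) || noArcB h c ab.2 (fun e => y (Sum.inl e))))
      (Fintype.card (Option (Lt m)) * 1) := by
    refine CktSize.pi_const fun o => ?_
    cases o with
    | none => exact (CktSize.proj B fun _ : Unit => (Sum.inr ab : St m)).of_le (Nat.zero_le 1)
    | some c => exact cktSize_term h hB ab.1 ab.2 c
  refine (hvec.comp (cktSize_andAll hB)).congr fun y u => ?_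
  simp only [roundF, Sum.elim_inr, Option.forall, Option.elim_none, Option.elim_some]
  cases y (Sum.inr ab) <;> simp

/-- A round costs at most `card² · (card + 2)` gates (input copies are free). [folklore] -/
theorem cktSize_roundF :
    CktSize B (roundF (m := m) h) (Fintype.card (Lt m × Lt m) * (Fintype.card (Option (Lt m)) * 1 + 1)) := by
  classical
  have := CktSize.pi (B := B) (f := fun (y : St m → Bool) (s : St m) => roundF h y s)
    (s := Sum.elim (fun _ => 0) fun _ => Fintype.card (Option (Lt m)) * 1 + 1) ?_
  · refine this.of_le (le_of_eq ?_)
    rw [Fintype.sum_sum_type]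
    simp
  · rintro (e | ab)
    · exact (CktSize.proj B fun _ : Unit => (Sum.inl e : St m)).congr fun y u => by simp [roundF]
    · exact cktSize_roundEntry h hB ab

/-- The initial state costs at most `card²` gates. [folklore] -/
theorem cktSize_initF : CktSize B (initF (m := m)) (Fintype.card (Lt m × Lt m) * 1) := by
  classical
  have := CktSize.pi (B := B) (f := fun (x : Ed m → Bool) (s : St m) => initF x s)
    (s := Sum.elim (fun _ => 0) fun _ => 1) ?_
  · refine this.of_le (le_of_eq ?_)
    rw [Fintype.sum_sum_type]; simp
  · rintro (e | ab)
    · exact (CktSize.proj B fun _ : Unit => e).congr fun y u => by simp [initF]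
    · exact (cktSize_constB hB (decide (ab.2 ≠ ab.1))).congr fun y u => by simp [initF]

omit hB in
/-- **Semantics of the programme**: after `n` rounds the table is non-membership in `reachSet`. [folklore] -/
theorem iterate_roundF_initF (x : Ed m → Bool) (n : ℕ) :
    (roundF h)^[n] (initF x) =
      Sum.elim x fun ab => decide (ab.2 ∉ reachSet (succB h x) ab.1 n) := by
  classical
  induction n with
  | zero =>
    funext s; rcases s with e | ⟨a, b⟩
    · rfl
    · simp [initF]
  | succ n ih =>
    rw [Function.iterate_succ_apply', ih]
    funext s; rcases s with e | ⟨a, b⟩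
    · rfl
    · simp only [roundF, Sum.elim_inr, Sum.elim_inl, reachSet_succ, nextSet, Finset.mem_union,
        Finset.mem_biUnion, not_or, not_exists, not_and]
      by_cases h1 : b ∈ reachSet (succB h x) a n
      · simp [h1]
      · simp only [h1, not_false_eq_true, decide_true, Bool.true_and, true_and]
        apply Bool.decide_congr
        refine forall_congr' fun c => ?_
        simp only [Bool.or_eq_true, decide_eq_true_eq, noArcB, Bool.not_eq_true', succB,
          Finset.mem_filter, Finset.mem_univ, true_and, Bool.not_eq_true]
        tauto

/-- Output stage: `⋀_u (C(p_u,¬p_u) ∨ C(¬p_u,p_u))`, `m + 1` gates. [folklore] -/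
theorem cktSize_outF :
    CktSize B (fun (y : St m → Bool) (_ : Unit) =>
      decide (∀ u : Fin m, (y (Sum.inr ((u, true), (u, false))) || y (Sum.inr ((u, false), (u, true)))) = true))
      (Fintype.card (Fin m) * 1 + 1) :=
  ((CktSize.pi_const (B := B) (f := fun (y : St m → Bool) (u : Fin m) =>
      (y (Sum.inr ((u, true), (u, false))) || y (Sum.inr ((u, false), (u, true)))))
    (fun _ => cktSize_or2 hB _ _)).comp (cktSize_andAll hB)).congr fun _ _ =>
      decide_eq_decide.mpr Iff.rfl

/-- Size of the per-colouring circuit. [folklore] -/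
def cutCircuitSize (m : ℕ) : ℕ :=
  Fintype.card (Lt m × Lt m) * 1 +
    Fintype.card (Lt m) * (Fintype.card (Lt m × Lt m) * (Fintype.card (Option (Lt m)) * 1 + 1)) +
    (Fintype.card (Fin m) * 1 + 1)

open Classical in
/-- **The per-colouring cut circuit**: `x ↦ [∀ u, Cut_h[p_u,¬p_u](x) ∨ Cut_h[¬p_u,p_u](x)]` has a
`B`-circuit of size `cutCircuitSize m = O(m⁴)`. [folklore] -/
theorem cktSize_cutTest :
    CktSize B (fun (x : Ed m → Bool) (_ : Unit) =>
      decide (∀ u : Fin m, Cut h x (u, true) (u, false) ∨ Cut h x (u, false) (u, true)))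
      (cutCircuitSize m) := by
  classical
  have h1 := ((cktSize_initF (m := m) hB).comp ((cktSize_roundF h hB).iterate (Fintype.card (Lt m)))).comp
    (cktSize_outF (m := m) hB)
  refine h1.congr fun x u => ?_
  simp only [iterate_roundF_initF, Sum.elim_inr]
  apply Bool.decide_congr
  refine forall_congr' fun v => ?_
  rw [cut_iff_not_mem_reachSet, cut_iff_not_mem_reachSet]
  simp only [Bool.or_eq_true, decide_eq_true_eq]

omit h in
open Classical in
/-- **The whole circuit**: OR over a family `𝓗` of colourings of the per-colouring cut tests,
`card 𝓗 · cutCircuitSize m + 1` gates. [folklore] -/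
theorem cktSize_family (𝓗 : Finset (Fin m → Fin k)) :
    CktSize B (fun (x : Ed m → Bool) (_ : Unit) =>
      decide (∃ h ∈ 𝓗, ∀ u : Fin m, Cut h x (u, true) (u, false) ∨ Cut h x (u, false) (u, true)))
      (Fintype.card ↥𝓗 * cutCircuitSize m + 1) := by
  classical
  have h1 := (CktSize.pi_const (B := B) (f := fun (x : Ed m → Bool) (i : ↥𝓗) =>
      decide (∀ u : Fin m, Cut i.1 x (u, true) (u, false) ∨ Cut i.1 x (u, false) (u, true)))
    (fun i => cktSize_cutTest (h := i.1) (hB := hB))).comp (cktSize_orAll hB)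
  refine h1.congr fun x u => ?_
  apply Bool.decide_congr
  constructor
  · rintro ⟨i, hi⟩
    exact ⟨i.1, i.2, by simpa using hi⟩
  · rintro ⟨h, hh, hc⟩
    exact ⟨⟨h, hh⟩, by simpa using hc⟩

end CutCircuit


end Summit.PneNP.PneNP.Theorems.CliqueExtLowerBound.Negative
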